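import Literature.NumberTheory.LFunctions.QuadraticCharacterShiftSumsTwo
import HarnessLib

/-!
# Complete shifted sums of quadratic characters: the `2`-adic factor and prime-power levels

Topic `Literature/NumberTheory/LFunctions`. Everything in this file is PROVED (theorems only).
Third of the four theorem files formalising Matomäki–Merikoski's Lemma 2.5 (complete sums
`∑_{m mod q} χ₀(m)χ₀(±m+h)`, `∑ χ(m)χ₀(±m+h)`, `∑ χ(m)χ(±m+h)` for a primitive quadratic `χ`
mod `q` and even `h`); the global statements are in `QuadraticCharacterShiftSums.lean`. Here:

* arithmetic of `twoAdicSign q h = 1_{φ(2^r) ∣ h}(−1)^{h/φ(2^r)}` (`r = v₂(q)`; defined in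
  `DirichletCharacterCRT.lean`): value `1` for odd `q`, the values at `q = 4, 8`, and
  multiplicativity over coprime moduli (`twoAdicSign_mul`), all for even `h`;
* the three sums at a prime-power level `p^n` carrying a primitive quadratic character
  (so `n = 1` for odd `p`, `n ∈ {2, 3}` for `p = 2`): `shiftSum_quad_quad_primePow`,
  `shiftSum_quad_one_primePow`, `shiftSum_one_one_primePow` — the cases "`q = p > 2`" and
  "`q = 2^r` with `r ∈ {2, 3}`" of the source's proof, assembled from
  `QuadraticCharacterShiftSumsLocal.lean` and `QuadraticCharacterShiftSumsTwo.lean`.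

## References

* K. Matomäki, J. Merikoski, *Siegel zeros, twin primes, Goldbach's conjecture, and primes in
  short intervals*, IMRN 2023 (arXiv:2112.11412), Lemma 2.5 and §3.4.
  [cite: MatomakiMerikoski2023, Lemma 2.5 and §3.4]
* H. L. Montgomery, R. C. Vaughan, *Multiplicative Number Theory I*, CUP 2007, §9.1 and §9.3.
  [cite: MontgomeryVaughan2007, §9.3]
-/

noncomputable section

open DirichletCharacter Finset

namespace Literature.NumberTheory.LFunctions

/-! ### Arithmetic of the `2`-adic factor -/

/-- `twoAdicSign` depends on `q` only through `v₂(q)`. [folklore] -/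
theorem twoAdicSign_eq_of_padicValNat_eq {q q' : ℕ} (e : padicValNat 2 q = padicValNat 2 q')
    (h : ℕ) : twoAdicSign q h = twoAdicSign q' h := by
  simp only [twoAdicSign_def, e]

/-- For odd `q` and even `h` the `2`-adic factor is `1` ("it is `1` for `r = 0` when `h` is
even"). [cite: MatomakiMerikoski2023, §3.4] -/
theorem twoAdicSign_of_not_two_dvd {q h : ℕ} (hq : ¬ 2 ∣ q) (hh : Even h) :
    twoAdicSign q h = 1 := by
  rw [twoAdicSign_def, padicValNat.eq_zero_of_not_dvd hq, pow_zero, Nat.totient_one,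
    if_pos (one_dvd h), Nat.div_one, hh.neg_one_pow]

/-- `twoAdicSign 4 h = (−1)^{h/2}` for even `h`. [cite: MatomakiMerikoski2023, §3.4] -/
theorem twoAdicSign_four {h : ℕ} (hh : Even h) :
    twoAdicSign 4 h = if 4 ∣ h then 1 else -1 := by
  have hv : padicValNat 2 4 = 2 := by
    rw [show (4 : ℕ) = 2 ^ 2 by norm_num, padicValNat.prime_pow]
  have ht : Nat.totient (2 ^ 2) = 2 := by decide
  obtain ⟨k, rfl⟩ := hh
  rw [twoAdicSign_def, hv, ht, if_pos (by omega), show (k + k) / 2 = k by omega]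
  rcases Nat.even_or_odd k with hk | hk
  · rw [hk.neg_one_pow, if_pos (by obtain ⟨j, rfl⟩ := hk; omega)]
  · rw [hk.neg_one_pow, if_neg (by obtain ⟨j, rfl⟩ := hk; omega)]

/-- `twoAdicSign 8 h = 1_{4 ∣ h}(−1)^{h/4}` for even `h`. [cite: MatomakiMerikoski2023, §3.4] -/
theorem twoAdicSign_eight {h : ℕ} (hh : Even h) :
    twoAdicSign 8 h = if 8 ∣ h then 1 else if 4 ∣ h then -1 else 0 := by
  have hv : padicValNat 2 8 = 3 := by
    rw [show (8 : ℕ) = 2 ^ 3 by norm_num, padicValNat.prime_pow]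
  have ht : Nat.totient (2 ^ 3) = 4 := by decide
  rw [twoAdicSign_def, hv, ht]
  by_cases h4 : 4 ∣ h
  · obtain ⟨k, rfl⟩ := h4
    rw [if_pos (dvd_mul_right 4 k), show 4 * k / 4 = k by omega]
    rcases Nat.even_or_odd k with hk | hk
    · rw [hk.neg_one_pow, if_pos (by obtain ⟨j, rfl⟩ := hk; omega)]
    · rw [hk.neg_one_pow, if_neg (by obtain ⟨j, rfl⟩ := hk; omega), if_pos (dvd_mul_right 4 k)]
  · rw [if_neg h4, if_neg (fun h8 => h4 ((by norm_num : (4 : ℕ) ∣ 8).trans h8)), if_neg h4]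

/-- Multiplicativity of the `2`-adic factor over coprime moduli (one of them is odd), for even
`h`. [folklore] -/
theorem twoAdicSign_mul {a b h : ℕ} (ha : a ≠ 0) (hb : b ≠ 0) (hab : a.Coprime b)
    (hh : Even h) : twoAdicSign (a * b) h = twoAdicSign a h * twoAdicSign b h := by
  have hmul : padicValNat 2 (a * b) = padicValNat 2 a + padicValNat 2 b := padicValNat.mul ha hb
  by_cases h2a : 2 ∣ a
  · have h2b : ¬ 2 ∣ b := fun h2b => by
      have := Nat.dvd_gcd h2a h2b
      rw [hab.gcd_eq_one] at this
      omega
    rw [twoAdicSign_of_not_two_dvd h2b hh, mul_one]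
    refine twoAdicSign_eq_of_padicValNat_eq ?_ h
    rw [hmul, padicValNat.eq_zero_of_not_dvd h2b, add_zero]
  · rw [twoAdicSign_of_not_two_dvd h2a hh, one_mul]
    refine twoAdicSign_eq_of_padicValNat_eq ?_ h
    rw [hmul, padicValNat.eq_zero_of_not_dvd h2a, zero_add]

/-! ### Prime-power moduli -/

section primePow

variable {p n : ℕ}

/-- A primitive character of level `> 1` is not principal. [cite: MontgomeryVaughan2007, §9.1] -/
theorem ne_one_of_isPrimitive {q : ℕ} [NeZero q] (hq : 1 < q) {χ : DirichletCharacter ℂ q}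
    (hprim : χ.IsPrimitive) : χ ≠ 1 := by
  rintro rfl
  rw [isPrimitive_def, conductor_one] at hprim
  omega

/-- The residue of an even `h` mod `4` is `0` or `2`. [folklore] -/
theorem natCast_zmod_four_of_even {h : ℕ} (hh : Even h) :
    ((h : ZMod 4) = 0 ∧ 4 ∣ h) ∨ ((h : ZMod 4) = 2 ∧ ¬ 4 ∣ h) := by
  obtain ⟨k, rfl⟩ := hh
  rcases Nat.even_or_odd k with ⟨j, rfl⟩ | ⟨j, rfl⟩
  · left
    refine ⟨?_, ⟨j, by ring⟩⟩
    rw [show j + j + (j + j) = 4 * j by ring, Nat.cast_mul, Nat.cast_ofNat,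
      show (4 : ZMod 4) = 0 by decide, zero_mul]
  · right
    refine ⟨?_, by omega⟩
    rw [show 2 * j + 1 + (2 * j + 1) = 4 * j + 2 by ring, Nat.cast_add, Nat.cast_mul,
      Nat.cast_ofNat, Nat.cast_ofNat, show (4 : ZMod 4) = 0 by decide, zero_mul, zero_add]

/-- The residue of an even `h` mod `8` is `0, 4` or `2, 6`, according to `8 ∣ h`, `4 ∥ h`,
`4 ∤ h`. [folklore] -/
theorem natCast_zmod_eight_of_even {h : ℕ} (hh : Even h) :
    ((h : ZMod 8) = 0 ∧ 8 ∣ h) ∨ ((h : ZMod 8) = 4 ∧ 4 ∣ h ∧ ¬ 8 ∣ h) ∨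
      (((h : ZMod 8) = 2 ∨ (h : ZMod 8) = 6) ∧ ¬ 4 ∣ h) := by
  have hmod : (h : ZMod 8) = ((h % 8 : ℕ) : ZMod 8) := (ZMod.natCast_mod h 8).symm
  obtain ⟨k, rfl⟩ := hh
  have hcases : (k + k) % 8 = 0 ∨ (k + k) % 8 = 2 ∨ (k + k) % 8 = 4 ∨ (k + k) % 8 = 6 := by omega
  rcases hcases with e | e | e | e
  · left; refine ⟨?_, by omega⟩; rw [hmod, e, Nat.cast_zero]
  · right; right; refine ⟨Or.inl ?_, by omega⟩; rw [hmod, e, Nat.cast_ofNat]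
  · right; left; refine ⟨?_, by omega, by omega⟩; rw [hmod, e, Nat.cast_ofNat]
  · right; right; refine ⟨Or.inr ?_, by omega⟩; rw [hmod, e, Nat.cast_ofNat]

/-- **(10) at a prime-power level.** For a primitive quadratic character `ψ` mod `p^n` and even
`h`: `∑_{m mod p^n} ψ(m)ψ(m + h) = p^n · twoAdicSign(p^n, h) · c_p`, `c_p = 1 − 1/p` if `p ∣ h`,
`−1/p` otherwise (the cases `q = p > 2` and `q = 2^r`, `r ∈ {2, 3}`, of the source's proof).
[cite: MatomakiMerikoski2023, §3.4] -/
theorem shiftSum_quad_quad_primePow (hp : p.Prime) (hn : 0 < n) [NeZero (p ^ n)]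
    (ψ : DirichletCharacter ℂ (p ^ n)) (hprim : ψ.IsPrimitive) (hquad : ψ.IsQuadratic) {h : ℕ}
    (hh : Even h) :
    shiftSum ψ ψ 1 (h : ZMod (p ^ n)) =
      ((p ^ n : ℕ) : ℂ) * (twoAdicSign (p ^ n) h : ℂ) *
        (if p ∣ h then 1 - 1 / (p : ℂ) else -1 / (p : ℂ)) := by
  have h2h : 2 ∣ h := even_iff_two_dvd.mp hh
  by_cases hp2 : p = 2
  · subst hp2
    rw [if_pos h2h]
    rcases eq_two_or_three_of_isPrimitive_two_pow hn ψ hprim hquad with rfl | rfl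
    · -- modulus `4`
      show shiftSum (q := 4) ψ ψ 1 ((h : ℕ) : ZMod 4) = ((4 : ℕ) : ℂ) * (twoAdicSign 4 h : ℂ) * _
      rcases natCast_zmod_four_of_even hh with ⟨ht, h4⟩ | ⟨ht, h4⟩
      · rw [shiftSum_quad_quad_four ψ hprim hquad (Or.inl ht), if_pos ht, twoAdicSign_four hh,
          if_pos h4]
        norm_num
      · rw [shiftSum_quad_quad_four ψ hprim hquad (Or.inr ht), if_neg (by rw [ht]; decide),
          twoAdicSign_four hh, if_neg h4]
        norm_num
    · -- modulus `8`
      show shiftSum (q := 8) ψ ψ 1 ((h : ℕ) : ZMod 8) = ((8 : ℕ) : ℂ) * (twoAdicSign 8 h : ℂ) * _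
      rcases natCast_zmod_eight_of_even hh with ⟨ht, h8⟩ | ⟨ht, h4, h8⟩ | ⟨ht, h4⟩
      · rw [shiftSum_quad_quad_eight ψ hprim hquad (Or.inl ht), if_pos ht, twoAdicSign_eight hh,
          if_pos h8]
        norm_num
      · rw [shiftSum_quad_quad_eight ψ hprim hquad (Or.inr (Or.inr (Or.inl ht))),
          if_neg (by rw [ht]; decide), if_pos ht, twoAdicSign_eight hh, if_neg h8, if_pos h4]
        norm_num
      · have hne0 : (h : ZMod 8) ≠ 0 := by rcases ht with ht | ht <;> rw [ht] <;> decide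
        have hne4 : (h : ZMod 8) ≠ 4 := by rcases ht with ht | ht <;> rw [ht] <;> decide
        have ht' : (h : ZMod 8) = 0 ∨ (h : ZMod 8) = 2 ∨ (h : ZMod 8) = 4 ∨ (h : ZMod 8) = 6 := by
          rcases ht with ht | ht
          · exact Or.inr (Or.inl ht)
          · exact Or.inr (Or.inr (Or.inr ht))
        rw [shiftSum_quad_quad_eight ψ hprim hquad ht', if_neg hne0, if_neg hne4,
          twoAdicSign_eight hh, if_neg (fun h8 => h4 ((by norm_num : (4:ℕ) ∣ 8).trans h8)),
          if_neg h4]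
        norm_num
  · -- odd prime: `n = 1`
    obtain rfl : n = 1 := eq_one_of_isPrimitive_pow_odd hp hp2 hn ψ hprim hquad
    haveI hF : Fact (p ^ 1).Prime := ⟨by rwa [pow_one]⟩
    have h1lt : 1 < p ^ 1 := by rw [pow_one]; exact hp.one_lt
    have hψ1 : ψ ≠ 1 := ne_one_of_isPrimitive h1lt hprim
    have key := sum_quad_quad_shift (p := p ^ 1) hquad hψ1 (σ := 1) (by norm_num)
      ((h : ℕ) : ZMod (p ^ 1))
    rw [shiftSum_def, key, map_one, twoAdicSign_of_not_two_dvd ?_ hh, Int.cast_one, mul_one]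
    swap
    · rw [pow_one]
      intro h2p
      exact hp2 ((Nat.prime_dvd_prime_iff_eq Nat.prime_two hp).mp h2p).symm
    have hp0 : (p : ℂ) ≠ 0 := Nat.cast_ne_zero.mpr hp.ne_zero
    have hdvd : ((h : ℕ) : ZMod (p ^ 1)) = 0 ↔ p ∣ h := by
      rw [ZMod.natCast_eq_zero_iff, pow_one]
    by_cases hph : p ∣ h
    · rw [if_pos (hdvd.mpr hph), if_pos hph, Nat.cast_pow, pow_one]
      field_simp
    · rw [if_neg (fun h0 => hph (hdvd.mp h0)), if_neg hph, Nat.cast_pow, pow_one]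
      field_simp

/-- **(9) at a prime-power level** (corrected sign, see the module docstring): for a primitive
quadratic `ψ` mod `p^n` and even `h`, `∑_{m mod p^n} ψ(m)χ₀(m + h) = −ψ(−h)` (which is `0` for
`p = 2`). [cite: MatomakiMerikoski2023, §3.4] -/
theorem shiftSum_quad_one_primePow (hp : p.Prime) (hn : 0 < n) [NeZero (p ^ n)]
    (ψ : DirichletCharacter ℂ (p ^ n)) (hprim : ψ.IsPrimitive) (hquad : ψ.IsQuadratic) {h : ℕ}
    (hh : Even h) :
    shiftSum ψ 1 1 (h : ZMod (p ^ n)) = -ψ (-(h : ZMod (p ^ n))) := by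
  by_cases hp2 : p = 2
  · subst hp2
    -- `ψ(−h) = 0` as `−h` is even
    have hnu : ¬ IsUnit (-((h : ℕ) : ZMod (2 ^ n))) := by
      rw [IsUnit.neg_iff, ZMod.isUnit_iff_coprime]
      intro hcop
      have h2 : 2 ∣ Nat.gcd h (2 ^ n) :=
        Nat.dvd_gcd (even_iff_two_dvd.mp hh) (dvd_pow_self 2 hn.ne')
      rw [hcop.gcd_eq_one] at h2
      omega
    rw [ψ.map_nonunit hnu, neg_zero]
    rcases eq_two_or_three_of_isPrimitive_two_pow hn ψ hprim hquad with rfl | rfl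
    · show shiftSum (q := 4) ψ 1 1 ((h : ℕ) : ZMod 4) = 0
      rcases natCast_zmod_four_of_even hh with ⟨ht, -⟩ | ⟨ht, -⟩
      · exact shiftSum_quad_one_four ψ hprim hquad (Or.inl ht)
      · exact shiftSum_quad_one_four ψ hprim hquad (Or.inr ht)
    · show shiftSum (q := 8) ψ 1 1 ((h : ℕ) : ZMod 8) = 0
      rcases natCast_zmod_eight_of_even hh with ⟨ht, -⟩ | ⟨ht, -, -⟩ | ⟨ht, -⟩
      · exact shiftSum_quad_one_eight ψ hprim hquad (Or.inl ht)
      · exact shiftSum_quad_one_eight ψ hprim hquad (Or.inr (Or.inr (Or.inl ht)))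
      · rcases ht with ht | ht
        · exact shiftSum_quad_one_eight ψ hprim hquad (Or.inr (Or.inl ht))
        · exact shiftSum_quad_one_eight ψ hprim hquad (Or.inr (Or.inr (Or.inr ht)))
  · obtain rfl : n = 1 := eq_one_of_isPrimitive_pow_odd hp hp2 hn ψ hprim hquad
    haveI hF : Fact (p ^ 1).Prime := ⟨by rwa [pow_one]⟩
    have h1lt : 1 < p ^ 1 := by rw [pow_one]; exact hp.one_lt
    have hψ1 : ψ ≠ 1 := ne_one_of_isPrimitive h1lt hprim
    have key := sum_quad_one_shift (p := p ^ 1) hψ1 (σ := 1) (by norm_num)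
      ((h : ℕ) : ZMod (p ^ 1))
    rw [shiftSum_def, key, neg_mul, one_mul]

end primePow

/-- **(8) at a prime-power level** carrying a primitive quadratic character: for even `h`,
`∑_{m mod p^n} χ₀(m)χ₀(m + h) = p^n (1 − 1/p)` if `p ∣ h`, `p^n(1 − 2/p)` otherwise
(`p − 1`, `p − 2`, `φ(2^r)` in the source's proof). [cite: MatomakiMerikoski2023, §3.4] -/
theorem shiftSum_one_one_primePow {p n : ℕ} (hp : p.Prime) (hn : 0 < n) [NeZero (p ^ n)]
    (ψ : DirichletCharacter ℂ (p ^ n)) (hprim : ψ.IsPrimitive) (hquad : ψ.IsQuadratic) {h : ℕ}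
    (hh : Even h) :
    shiftSum (1 : DirichletCharacter ℂ (p ^ n)) 1 1 (h : ZMod (p ^ n)) =
      ((p ^ n : ℕ) : ℂ) * (if p ∣ h then 1 - 1 / (p : ℂ) else 1 - 2 / (p : ℂ)) := by
  have h2h : 2 ∣ h := even_iff_two_dvd.mp hh
  by_cases hp2 : p = 2
  · subst hp2
    rw [if_pos h2h]
    rcases eq_two_or_three_of_isPrimitive_two_pow hn ψ hprim hquad with rfl | rfl
    · show shiftSum (q := 4) 1 1 1 ((h : ℕ) : ZMod 4) = ((4 : ℕ) : ℂ) * _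
      rcases natCast_zmod_four_of_even hh with ⟨ht, -⟩ | ⟨ht, -⟩
      · rw [shiftSum_one_one_four (Or.inl ht)]; norm_num
      · rw [shiftSum_one_one_four (Or.inr ht)]; norm_num
    · show shiftSum (q := 8) 1 1 1 ((h : ℕ) : ZMod 8) = ((8 : ℕ) : ℂ) * _
      rcases natCast_zmod_eight_of_even hh with ⟨ht, -⟩ | ⟨ht, -, -⟩ | ⟨ht, -⟩
      · rw [shiftSum_one_one_eight (Or.inl ht)]; norm_num
      · rw [shiftSum_one_one_eight (Or.inr (Or.inr (Or.inl ht)))]; norm_num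
      · rcases ht with ht | ht
        · rw [shiftSum_one_one_eight (Or.inr (Or.inl ht))]; norm_num
        · rw [shiftSum_one_one_eight (Or.inr (Or.inr (Or.inr ht)))]; norm_num
  · obtain rfl : n = 1 := eq_one_of_isPrimitive_pow_odd hp hp2 hn ψ hprim hquad
    haveI hF : Fact (p ^ 1).Prime := ⟨by rwa [pow_one]⟩
    have key := sum_one_one_shift (p := p ^ 1) (σ := 1) (by norm_num) ((h : ℕ) : ZMod (p ^ 1))
    rw [shiftSum_def, key]
    have hp0 : (p : ℂ) ≠ 0 := Nat.cast_ne_zero.mpr hp.ne_zero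
    have hdvd : ((h : ℕ) : ZMod (p ^ 1)) = 0 ↔ p ∣ h := by
      rw [ZMod.natCast_eq_zero_iff, pow_one]
    by_cases hph : p ∣ h
    · rw [if_pos (hdvd.mpr hph), if_pos hph, Nat.cast_pow, pow_one]
      field_simp
    · rw [if_neg (fun h0 => hph (hdvd.mp h0)), if_neg hph, Nat.cast_pow, pow_one]
      field_simp

end Literature.NumberTheory.LFunctions
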